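import Summits.ABC.IUTFork.Conditional.HexHullThresholdGenuine
import Summits.ABC.IUTFork.Cor312LicenceTripleUnconditional
import HarnessLib

/-!
# The hull licence at the `K`-level datum of an abc triple REFUTED from ONE failing hull cell at a tame pole of PINNED local type
# («W:TRIPLE-HULLCELL-SOCKET», negative twin of abc-iut-W-row-1's `WRow.licence_triple_unconditional`)

PROOF-ONLY file (D-0012; 0 definitions, 0 `Prop` facts, no instance) of the abc-iut cell — D-0079 RESCUE sub-cell R-W «WINDOW Θ-SIDE
INEQUALITY», seat abc-iut-w5-d009 (gen 14), row «W:GAP-1019». It is the NEGATIVE-side socket matching abc-iut-W-row-1's positive socket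
`WRow.licence_triple_unconditional` (`Cor312LicenceTripleUnconditional`, p485974): abc-iut-rh-typ-4's engine
`RH.HullThresholdExactRefute.not_licence_settingPrVolSharp_of_not_hullCell` (p462895; over abc-iut-w4-d036's U2-LICENCE-WRAPPER
`licence_settingPrVolSharp_iff_shellRadii_of_realises`, p460573) read at the `K`-level pilot datum `pilotDataOfK T.D T.K` of a genuine
Θ-volume datum `T` over the Frey–Legendre point `ratPoint (a/c)` of an abc triple, at ONE bad fibre point `x₀ | p` over a pole prime
`p ∣ abc`, `p ∉ {2, l}`, whose local type is PINNED by hypothesis (`e(K_{x₀}/ℚ_p) = e₀`, `p ∤ e₀`): the pattern of abc-iut-rh-typ-4's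
`GenuineK.not_pilotKummerCompatHull_lamSeven_of_not_hullCell` (`HexHullThresholdGenuine`, HEX datum) transported to abc triples with the
triple plumbing of abc-iut-W-row-1 / W-row-2 / w4-d026 (`Cor312Prov.norm_chosenQIdele_le_rpow_of_ratPoint'` badness,
`Cor22.ord_jInv_ratPoint_triple_eq`, `Cor312Prov.qPilot_pilotDataOfK_eq_of_ord_rat`). TAKES NO SIDE on [IUTchIII] Cor. 3.12
(S. Mochizuki, *Inter-universal Teichmüller theory III*, Cor. 3.12 p. 173–174; Step (xi-f) p. 184) or on any author; «refuted as typed» ≠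
«refuted in print».

WHAT IS PROVED (namespace `Summit.ABC.IUTFork.Conditional`):
* **`WRow.not_licence_triple_of_not_hullCell`** — abc triple `(a, b, c)`, ANY level `l`, a genuine Θ-volume datum `T` at `(ratPoint (a/c), l)`,
  a pole prime `p ∣ abc` with `p ≠ 2, l`, natural numbers `e₀, P, i, a₀` with: every fibre point `x₀ | p` has `e(K_{x₀}/ℚ_p) = e₀`,
  `p ∤ e₀` (tame type), `e₀·v_p(abc) = l·P` (so `P_q(x₀) = P`), `i + 1 ≤ l⋆`, `a₀` the turning point of `e₀`
  (`p^t(p−1) < e₀` for `t < a₀`, `e₀ ≤ p^{a₀}(p−1)`), and the closed-form column of R-H row 4 FAILS: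
  `¬ HullCell e₀ P (i+1) (⌊e₀/(p−1)⌋+1) (p^{a₀} − a₀·e₀)` — THEN for EVERY pair of realising Θ- and q-ideles abc-iut-c312-1's
  `Thm311ToCor312.Licence` FAILS at abc-iut-c312-7's `settingPrVolSharp (pilotDataOfK T.D T.K) …`.
* **`WRow.not_exists_qPinned_and_hull_triple_of_not_hullCell`** — hence branch C's per-datum antecedent «∃ ρ qK, QPinned ∧
  PilotKummerCompatHull» FAILS there (any columns), the binder shape of the window certificates (`hSHw`/`hSHwBad`, p453137 / p450130).
(The instance shape at the CHOSEN realising ideles — `LatticeSituation.ofShells …`, pinned reading — follows per row from the first theorem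
and abc-iut-c312-1's `licence_of_pilotKummerCompatHull`; see the row files `Conditional/WRowFrey…Gap…`.)
WHY the three local inputs hold BY NAME at `x₀`: the inner radius of `log_p(𝒪^×_{K_{x₀}})` is `≥ p^{−(⌊e₀/(p−1)⌋+1)/e₀}`
(`HexHullThreshold.rpow_le_norm_of_innerRadius`, abc-iut-S1's `pBall_subset_logUnits_of_lt`), the outer radius is `≤ p^{−(p^{a₀} − a₀e₀)/e₀}`
(`HexHullThreshold.norm_le_rpow_of_mem_logUnits_turning`, abc-iut-rp-x2's sharp envelope), and the different of the tame-type `K_{x₀}` is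
`(e₀−1)/e₀` (`differentOrd_eq_of_not_dvd`, `differentOrd_le_differentOrd_dFac`). Compared with the [LIN]/[ED] engines (p438886 / p464182) the
column keeps the floor and the EXACT envelope exponent `min_t(p^t − t·e)` instead of print's `b_e ≤ B − 1/e`, which is what decides rows with
`30·l > p^B(p−1)` at large `B` (the R-W numerics lead's «gap» rows between the [LIN] band and the inhabited certificate).
READING (neutral; numbers, not adjectives): a sufficient condition for the per-datum S_H object to FAIL at the data of the class
`(ratPoint (a/c), l)` WITH THE STATED LOCAL TYPE AT `p`; admissibility / Szpiro-badness / (P6) / NON-EMPTINESS of that sub-class are NOT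
claimed. HONEST SCOPE: OUR sharp containers (Θ-regions constant in `m`) and Dupuy–Hilado's typed (Ind1)/(Ind2); STRONGER-THAN-PRINT hull
reading; nothing about the printed inequality, the number-level corollary or any author's intended hull; typed ≠ proved; instantiated ≠
endorsed; no abc claim.
[cite: Mochizuki2012, IUTchI Def. 3.1 (b),(c) pp. 61–62, Ex. 3.2 (iv) p. 71; IUTchIII Cor. 3.12 Step (xi-f) p. 184; IUTchIV Prop. 1.1 p. 9, Prop. 1.2 (i)(ii) p. 10, Cor. 2.2 (ii) proof (P5) p. 46]
[cite: DupuyHilado2025, §3.3, §3.4, §4.9, §4.12] [cite: NeukirchANT1999, Ch. II (5.5)–(5.7)] [cite: SerreLocalFields1979, Ch. III §6 Prop. 13]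
[cite: SilvermanAEC2009, Prop. III.1.7(b)] [claim: Mochizuki2012, status: disputed] for every IUT sentence.
-/

noncomputable section

open Set Function Metric NumberField IsDedekindDomain

namespace Summit.ABC.IUTFork.Conditional

open Thm311 Thm311.Real Cor312 Cor312Vol Cor312Prov Literature.IUT.LogThetaLattice Literature.IUT.LogVolume
  Literature.IUT.HodgeTheaters Literature.IUT.LogVolume.Cor22 Literature.IUT.LogVolume.ThetaData
open Literature.NumberTheory.NumberFields Literature.NumberTheory.GaloisRepresentations.Ultrametric
open Literature.NumberTheory.DiophantineGeometry Literature.NumberTheory.DiophantineGeometry.GenEll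
open Summit.ABC.IUTFork.Repair.RH.HullThresholdExact Summit.ABC.IUTFork.Repair.RH.HullThresholdExactRefute

/-! ## The licence REFUTED at the `K`-level datum of an abc triple from one failing hull cell at a tame pole of pinned local type -/

/-- **THE HULL LICENCE FAILS AT THE `K`-LEVEL DATUM OF AN abc TRIPLE WHEN R-H ROW 4's COLUMN FAILS AT A TAME POLE OF PINNED LOCAL TYPE.**
`a + b = c` an abc triple, `l` any level, `T` a genuine Θ-volume datum at `(ratPoint (a/c), l)` ([IUTchIV] Cor. 2.2 (ii) proof (P7)), Θ- and
q-ideles REALISING the pilot divisors of `X := pilotDataOfK T.D T.K`; a prime `p ∣ abc`, `p ≠ 2, l`; `e₀, P, i, a₀ ∈ ℕ` with: every fibre point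
`x₀ | p` has `e(K_{x₀}/ℚ_p) = e₀`; `p ∤ e₀`; `e₀·v_p(abc) = l·P`; `i + 1 ≤ (l−1)/2`; `p^t(p−1) < e₀` for `t < a₀` and `e₀ ≤ p^{a₀}(p−1)`;
`¬ HullCell e₀ P (i+1) (⌊e₀/(p−1)⌋+1) (p^{a₀} − a₀·e₀)`. THEN `¬ Thm311ToCor312.Licence (settingPrVolSharp X …)`. Proof BY NAME: every `x₀ | p`
is BAD (`Cor312Prov.norm_chosenQIdele_le_rpow_of_ratPoint'`, the (P5) choice) with `ord j(a/c) = −2v_p(abc)` below it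
(`Cor22.ord_jInv_ratPoint_triple_eq`), so `P_q(x₀) = e₀·2v_p/(2l) = P` (`Cor312Prov.qPilot_pilotDataOfK_eq_of_ord_rat`); the inner/outer radii of
`log_p(𝒪^×_{K_x})` exist at every place (`HexHullThreshold.exists_innerRadius` / `exists_outerRadius`) with the certified bounds
`p^{−(⌊e₀/(p−1)⌋+1)/e₀} ≤ ‖cin x₀‖` (`rpow_le_norm_of_innerRadius`), `‖cout x₀‖ ≤ p^{−(p^{a₀} − a₀e₀)/e₀}` (`norm_le_rpow_of_mem_logUnits_turning`);
the tame-type different `(e₀−1)/e₀` bounds the defect of the diagonal packet (`differentOrd_eq_of_not_dvd`, `differentOrd_le_differentOrd_dFac`);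
abc-iut-rh-typ-4's `not_licence_settingPrVolSharp_of_not_hullCell` concludes.
[cite: Mochizuki2012, IUTchI Ex. 3.2 (iv) p. 71; IUTchIII Cor. 3.12 Step (xi-f) p. 184; IUTchIV Prop. 1.1 p. 9, Prop. 1.2 (i)(ii) p. 10, Cor. 2.2 (ii) proof (P5) p. 46]
[cite: DupuyHilado2025, §3.4, §4.9, §4.12] [cite: SerreLocalFields1979, Ch. III §6 Prop. 13] [claim: Mochizuki2012, status: disputed] -/
theorem WRow.not_licence_triple_of_not_hullCell {a b c l : ℕ} (habc : IsABCTriple a b c)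
    (T : Cor22.ThetaVolumeDatumAt (ratPoint ((a : ℚ) / c)) l) (pp : Nat.Primes) (hp2 : (pp : ℕ) ≠ 2) (hpl : (pp : ℕ) ≠ l)
    (hpabc : (pp : ℕ) ∣ a * b * c) {e₀ P i a₀ : ℕ} (hpe : ¬ (pp : ℕ) ∣ e₀)
    (hloc : letI := T.instFieldF; letI := T.instNumberFieldF; letI := T.instAlgebraF; letI := T.instFieldK
      letI := T.instNumberFieldK; letI := T.instAlgebraK; letI := T.instFieldFbar; letI := T.instAlgebraFbar
      letI := T.instAlgebraKFbar; letI := T.instIsElliptic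
      haveI : Fact (pp : ℕ).Prime := ⟨pp.2⟩
      ∀ x₀ : (thetaIndex (pilotDataOfK T.D T.K)).Fibre (.inr pp),
        absRamificationIdx (pp : ℕ) (kOf (pilotDataOfK T.D T.K) pp.1 x₀) = e₀)
    (hP : e₀ * (a * b * c).factorization pp = l * P) (hi : i + 1 ≤ (l - 1) / 2)
    (hlo : ∀ t : ℕ, t < a₀ → (1 : ℤ) * ((pp : ℕ) : ℤ) ^ t * (((pp : ℕ) : ℤ) - 1) < (e₀ : ℤ))
    (hhi : (e₀ : ℤ) ≤ 1 * ((pp : ℕ) : ℤ) ^ a₀ * (((pp : ℕ) : ℤ) - 1))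
    (hneg : ¬ HullCell (e₀ : ℤ) (P : ℤ) ((i : ℤ) + 1) ((e₀ / ((pp : ℕ) - 1) + 1 : ℕ) : ℤ)
      (((pp : ℕ) : ℤ) ^ a₀ - (a₀ : ℤ) * (e₀ : ℤ))) :
    letI := T.instFieldF; letI := T.instNumberFieldF; letI := T.instAlgebraF; letI := T.instFieldK
    letI := T.instNumberFieldK; letI := T.instAlgebraK; letI := T.instFieldFbar; letI := T.instAlgebraFbar
    letI := T.instAlgebraKFbar; letI := T.instIsElliptic
    ∀ {logv : PadicLogs T.K} (hlog : LogvAnalytic logv) (M : Type) [Field M] [NumberField M]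
      (archPk : ∀ (j : (thetaIndex (pilotDataOfK T.D T.K)).Label) (vQ : (thetaIndex (pilotDataOfK T.D T.K)).VQ),
        Set ((logShellsDH (pilotDataOfK T.D T.K) logv).Packet j vQ))
      (archSub : ∀ (j : (thetaIndex (pilotDataOfK T.D T.K)).Label) (v : (thetaIndex (pilotDataOfK T.D T.K)).V),
        Set ((logShellsDH (pilotDataOfK T.D T.K) logv).Packet j ((thetaIndex (pilotDataOfK T.D T.K)).over v)))
      (Ψ : ℤ → ∀ v : (thetaIndex (pilotDataOfK T.D T.K)).V, v ∈ (thetaIndex (pilotDataOfK T.D T.K)).Vbad →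
        Set ((logShellsDH (pilotDataOfK T.D T.K) logv).StarPacket v))
      (act : ℤ → ∀ v : (thetaIndex (pilotDataOfK T.D T.K)).V, v ∈ (thetaIndex (pilotDataOfK T.D T.K)).Vbad →
        (logShellsDH (pilotDataOfK T.D T.K) logv).StarPacket v → Module.End ℚ ((logShellsDH (pilotDataOfK T.D T.K) logv).StarPacket v))
      (Mmod : ℤ → ∀ j : (thetaIndex (pilotDataOfK T.D T.K)).LabelStar, Set ((logShellsDH (pilotDataOfK T.D T.K) logv).GlobalPacket j.1))
      (region : ℤ → ∀ j : (thetaIndex (pilotDataOfK T.D T.K)).LabelStar, FinDivisor M → ∀ vQ : (thetaIndex (pilotDataOfK T.D T.K)).VQ,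
        Set ((logShellsDH (pilotDataOfK T.D T.K) logv).Packet j.1 vQ))
      (n : ℤ) {HT : Type} {LogLink : HT → HT → Type} {IsFull : ∀ {s t : HT}, LogLink s t → Prop}
      (lat : LGPGaussianLogThetaLattice LogLink IsFull)
      {Frd : Type} {IsoF : Frd → Frd → Type} {Ob : Frd → Type} {realify : Frd → Frd} {Strip : Type}
      {IsoS : Strip → Strip → Type} {Mv : ∀ v : (thetaIndex (pilotDataOfK T.D T.K)).V, v ∈ (thetaIndex (pilotDataOfK T.D T.K)).Vbad → Type}
      [∀ v h, Monoid (Mv v h)]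
      (sig : GlobalLGPFrobenioidSignature (thetaIndex (pilotDataOfK T.D T.K)).lstar (thetaIndex (pilotDataOfK T.D T.K)).V
        (· ∈ (thetaIndex (pilotDataOfK T.D T.K)).Vbad) Frd IsoF Ob realify Strip IsoS Mv)
      (split : SplittingMonoids Mv) {ObΔ : Type} {N : ∀ v : (thetaIndex (pilotDataOfK T.D T.K)).V, v ∈ (thetaIndex (pilotDataOfK T.D T.K)).Vbad → Type}
      [∀ v h, Monoid (N v h)] (qData : QPilotData ObΔ N)
      (tq : ∀ (pp : Nat.Primes) (x : (thetaIndex (pilotDataOfK T.D T.K)).Fibre (.inr pp)),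
        haveI : Fact (pp : ℕ).Prime := ⟨pp.2⟩; kOf (pilotDataOfK T.D T.K) pp.1 x)
      (t : ∀ (pp : Nat.Primes) (_ : Fin (pilotDataOfK T.D T.K).lstar) (x : (thetaIndex (pilotDataOfK T.D T.K)).Fibre (.inr pp)),
        haveI : Fact (pp : ℕ).Prime := ⟨pp.2⟩; kOf (pilotDataOfK T.D T.K) pp.1 x)
      (htq0 : ∀ pp x, tq pp x ≠ 0)
      (htq1 : ∀ (pp : Nat.Primes) (x : (thetaIndex (pilotDataOfK T.D T.K)).Fibre (.inr pp)),
        haveI : Fact (pp : ℕ).Prime := ⟨pp.2⟩; placeOf (pilotDataOfK T.D T.K) pp.1 x ∉ (pilotDataOfK T.D T.K).S → ‖tq pp x‖ = 1)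
      (_ht0 : ∀ pp i x, t pp i x ≠ 0)
      (_ht : ∀ (pp : Nat.Primes) (i : Fin (pilotDataOfK T.D T.K).lstar) (x : (thetaIndex (pilotDataOfK T.D T.K)).Fibre (.inr pp)),
        haveI : Fact (pp : ℕ).Prime := ⟨pp.2⟩
        Real.log ‖t pp i x‖ = -((pilotDataOfK T.D T.K).thetaPilot i (placeOf (pilotDataOfK T.D T.K) pp.1 x)) *
          logNorm T.K (placeOf (pilotDataOfK T.D T.K) pp.1 x) / localDegree T.K (placeOf (pilotDataOfK T.D T.K) pp.1 x))
      (_htq : ∀ (pp : Nat.Primes) (x : (thetaIndex (pilotDataOfK T.D T.K)).Fibre (.inr pp)),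
        haveI : Fact (pp : ℕ).Prime := ⟨pp.2⟩
        Real.log ‖tq pp x‖ = -((pilotDataOfK T.D T.K).qPilot (placeOf (pilotDataOfK T.D T.K) pp.1 x)) *
          logNorm T.K (placeOf (pilotDataOfK T.D T.K) pp.1 x) / localDegree T.K (placeOf (pilotDataOfK T.D T.K) pp.1 x)),
      ¬ Thm311ToCor312.Licence
        (settingPrVolSharp (pilotDataOfK T.D T.K) hlog M archPk archSub Ψ act Mmod region n lat sig split qData tq t htq0 htq1) := by
  classical
  letI := T.instFieldF; letI := T.instNumberFieldF; letI := T.instAlgebraF; letI := T.instFieldK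
  letI := T.instNumberFieldK; letI := T.instAlgebraK; letI := T.instFieldFbar; letI := T.instAlgebraFbar
  letI := T.instAlgebraKFbar; letI := T.instIsElliptic
  haveI hppI : Fact (pp : ℕ).Prime := ⟨pp.2⟩
  set X := pilotDataOfK T.D T.K with hXdef
  intro logv hlog M _ _ archPk archSub Ψ act Mmod region n HT LogLink IsFull lat Frd IsoF Ob realify Strip
    IsoS Mv _ sig split ObΔ N _ qData tq t htq0 htq1 ht0 ht htq
  -- numerics of the prime, the level and the local type
  have hp1 : 1 < (pp : ℕ) := pp.2.one_lt
  have hq0 : 0 < (pp : ℕ) - 1 := by omega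
  have hp1r : (1 : ℝ) < ((pp : ℕ) : ℝ) := by exact_mod_cast hp1
  have hp0r : (0 : ℝ) < ((pp : ℕ) : ℝ) := by linarith
  have ha : 0 < a := habc.1
  have hb : 0 < b := habc.2.1
  have hc : 0 < c := by have := habc.2.2.1; omega
  have habc0 : a * b * c ≠ 0 := by positivity
  set v : ℕ := (a * b * c).factorization pp with hvdef
  have hv : 0 < v := Nat.Prime.factorization_pos_of_dvd pp.2 habc0 hpabc
  have hl5 : 5 ≤ l := T.D.five_le_l
  have hl0r : (0 : ℝ) < l := by exact_mod_cast (show 0 < l by omega)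
  -- a fibre point over `p`; it is BAD, and the pole order of `j(a/c)` below it is `−2v`
  obtain ⟨u, hu⟩ := (thetaIndex X).fibre_nonempty (.inr pp)
  set x₀ : (thetaIndex X).Fibre (.inr pp) := ⟨u, hu⟩ with hx₀def
  have hjF : T.E.j = ((jInv ((a : ℚ) / c) : ℚ) : T.F) := by rw [T.j_eq]; exact eq_ratCast _ _
  have hpole : ∀ w : HeightOneSpectrum (𝓞 ℚ), Rat.HeightOneSpectrum.natGenerator w = (pp : ℕ) →
      ord ℚ w (jInv ((a : ℚ) / c)) = -(2 * ((v : ℕ) : ℤ)) := by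
    intro w hw
    rw [Cor22.ord_jInv_ratPoint_triple_eq habc w (by rw [hw]; exact hp2) (by rw [hw]; exact hpabc), hw]
  have hord : ∀ w : HeightOneSpectrum (𝓞 ℚ), Rat.HeightOneSpectrum.natGenerator w = (pp : ℕ) →
      ord ℚ w (Cor22.jInv ((a : ℚ) / c)) ≤ -((1 : ℕ) : ℤ) := by
    intro w hw
    rw [hpole w hw]
    have : (0 : ℤ) < v := by exact_mod_cast hv
    push_cast
    linarith
  obtain ⟨hx, -⟩ := norm_chosenQIdele_le_rpow_of_ratPoint' T.D ((a : ℚ) / c) T.j_eq T.isP5Choice pp x₀ hp2 hpl 1 le_rfl hord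
  -- the local type at `x₀`
  set e : ℕ := absRamificationIdx (pp : ℕ) (kOf X (pp : ℕ) x₀) with he
  have hee₀ : e = e₀ := hloc x₀
  have he0 : 0 < e₀ := by rw [← hee₀]; exact absRamificationIdx_pos (pp : ℕ) _
  have he0r : (0 : ℝ) < (e₀ : ℝ) := by exact_mod_cast he0
  have heram : ramIdx T.K (placeOf X (pp : ℕ) x₀) = e₀ := by
    rw [← hee₀, he, ramIdx_eq]
    exact (absRamificationIdx_rescaledCompletion T.K (pp : ℕ) (placeOf X (pp : ℕ) x₀) (natCast_mem_placeOf X (pp : ℕ) x₀)).symm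
  have heram' : (ramIdx T.K (placeOf X (pp : ℕ) x₀) : ℤ) = (e₀ : ℤ) := by rw [heram]
  have hek : absRamificationIdx (pp : ℕ) ((presAt X hlog pp).k x₀) = e₀ := hee₀
  have htame' : ¬ (pp : ℕ) ∣ absRamificationIdx (pp : ℕ) ((presAt X hlog pp).k x₀) := by rw [hek]; exact hpe
  -- the pilot degree `P_q(x₀) = e₀·2v/(2l) = P`
  have hordv : ord ℚ (finBelow ℚ T.K (placeOf X (pp : ℕ) x₀)) (jInv ((a : ℚ) / c)) = -((2 * v : ℕ) : ℤ) := by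
    rw [hpole _ (natGenerator_finBelow_placeOf T.D pp x₀)]
    push_cast
    ring
  have hPq : X.qPilot (placeOf X (pp : ℕ) x₀) = (P : ℝ) := by
    have h1 := Cor312Prov.qPilot_pilotDataOfK_eq_of_ord_rat T.D (jInv ((a : ℚ) / c)) hjF pp x₀ hx hee₀ hordv
    have h2 : ((e₀ * v : ℕ) : ℝ) = ((l * P : ℕ) : ℝ) := by rw [hvdef, hP]
    push_cast at h2
    rw [h1]
    push_cast
    field_simp
    linarith
  -- the inner and outer radii at every place (abc-iut-w4-d036's binders)
  have hIn : ∀ (pp : Nat.Primes) (x : (thetaIndex X).Fibre (.inr pp)),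
      haveI : Fact (pp : ℕ).Prime := ⟨pp.2⟩
      ∃ (c : (presAt X hlog pp).k x) (ϖ : ((presAt X hlog pp).k x)ˣ) (w : (presAt X hlog pp).k x), c ≠ 0 ∧
        (∀ o : (presAt X hlog pp).k x, ‖o‖ ≤ 1 → c * o ∈ logUnits ((presAt X hlog pp).k x)) ∧
        IsUniformizer ϖ ∧ w ∉ logUnits ((presAt X hlog pp).k x) ∧ ‖w‖ * ‖(ϖ : (presAt X hlog pp).k x)‖ ≤ ‖c‖ := fun pp x => by
    haveI : Fact (pp : ℕ).Prime := ⟨pp.2⟩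
    exact HexHullThreshold.exists_innerRadius (pp : ℕ) ((presAt X hlog pp).k x)
  choose cin ϖ w hin0 hin hunif hw hwle using hIn
  have hOut : ∀ (pp : Nat.Primes) (x : (thetaIndex X).Fibre (.inr pp)),
      haveI : Fact (pp : ℕ).Prime := ⟨pp.2⟩
      ∃ c : (presAt X hlog pp).k x, c ∈ logUnits ((presAt X hlog pp).k x) ∧ c ≠ 0 ∧
        ∀ z ∈ logUnits ((presAt X hlog pp).k x), ‖z‖ ≤ ‖c‖ := fun pp x => by
    haveI : Fact (pp : ℕ).Prime := ⟨pp.2⟩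
    exact HexHullThreshold.exists_outerRadius (pp : ℕ) ((presAt X hlog pp).k x)
  choose cout houtΛ hout0 hdom using hOut
  -- the label
  have hlstar : (thetaIndex X).lstar = (l - 1) / 2 := by
    show ((pilotDataOfK T.D T.K).l - 1) / 2 = (l - 1) / 2
    rw [pilotDataOfK_l]
  have hil : i < (thetaIndex X).lstar := by rw [hlstar]; omega
  refine not_licence_settingPrVolSharp_of_not_hullCell X hlog M archPk archSub Ψ act Mmod region n lat sig split qData tq t htq0 htq1
    ht0 ht htq cin cout hin0 hin (fun pp x => ⟨ϖ pp x, w pp x, hunif pp x, hw pp x, hwle pp x⟩) hout0 houtΛ hdom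
    pp ⟨i, hil⟩ x₀ (P := P) (rinUb := ((e₀ / ((pp : ℕ) - 1) + 1 : ℕ) : ℤ))
    (routLb := ((pp : ℕ) : ℤ) ^ a₀ - (a₀ : ℤ) * (e₀ : ℤ)) hPq ?_ ?_ ?_ ?_
  · -- hcin: `p^{−r_in/e₀} ≤ ‖cin x₀‖` with `r_in = ⌊e₀/(p−1)⌋ + 1`
    have hr : 1 / (((pp : ℕ) : ℝ) - 1) < ((((e₀ / ((pp : ℕ) - 1) + 1 : ℕ) : ℤ)) : ℝ) /
        (absRamificationIdx (pp : ℕ) ((presAt X hlog pp).k x₀) : ℝ) := by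
      rw [hek]
      have hq : e₀ < ((pp : ℕ) - 1) * (e₀ / ((pp : ℕ) - 1) + 1) := Nat.lt_mul_div_succ e₀ hq0
      have hqr : (e₀ : ℝ) < ((((pp : ℕ) - 1 : ℕ)) : ℝ) * (((e₀ / ((pp : ℕ) - 1) + 1 : ℕ)) : ℝ) := by exact_mod_cast hq
      have hsub : ((((pp : ℕ) - 1 : ℕ)) : ℝ) = ((pp : ℕ) : ℝ) - 1 := by
        rw [Nat.cast_sub hp1.le, Nat.cast_one]
      rw [hsub] at hqr
      have hq0r : (0 : ℝ) < ((pp : ℕ) : ℝ) - 1 := by linarith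
      rw [lt_div_iff₀ he0r, one_div, inv_mul_lt_iff₀ hq0r]
      simp only [Int.cast_natCast]
      exact hqr
    have h := HexHullThreshold.rpow_le_norm_of_innerRadius (pp : ℕ) _ (hunif _ x₀) (hw _ x₀) (hwle _ x₀) hr
    rw [hek] at h
    rw [heram']
    convert h using 2
    push_cast
    ring
  · -- hcout: `‖cout x₀‖ ≤ p^{−r_out/e₀}` with `r_out = p^{a₀} − a₀·e₀`
    have hlo' : ∀ t < a₀, (1 : ℤ) * (((pp : ℕ) : ℕ) : ℤ) ^ t * ((((pp : ℕ) : ℕ) : ℤ) - 1) <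
        absRamificationIdx (pp : ℕ) ((presAt X hlog pp).k x₀) := by
      rw [hek]; exact fun t ht => hlo t ht
    have hhi' : (absRamificationIdx (pp : ℕ) ((presAt X hlog pp).k x₀) : ℤ) ≤
        1 * (((pp : ℕ) : ℕ) : ℤ) ^ a₀ * ((((pp : ℕ) : ℕ) : ℤ) - 1) := by
      rw [hek]; exact hhi
    have h := HexHullThreshold.norm_le_rpow_of_mem_logUnits_turning (pp : ℕ) _ hlo' hhi' (houtΛ _ x₀)
    rw [hek] at h
    rw [heram']
    convert h using 2
  · -- hd: the different defect of the diagonal packet at a TAME-type place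
    intro J
    have hcard : Fintype.card ((thetaIndex X).Caps (Setting.labelSucc ⟨i, hil⟩)) = i + 2 := by
      rw [Fintype.card_fin]
      simp only [Setting.labelSucc, Fin.val_succ]
    have hdiff : differentOrd (pp : ℕ) ((presAt X hlog pp).k x₀) = ((e₀ : ℝ) - 1) / (e₀ : ℝ) := by
      rw [differentOrd_eq_of_not_dvd (pp : ℕ) _ htame', hek]
    have hfac := differentOrd_le_differentOrd_dFac (pp : ℕ) ((presAt X hlog pp).kk
      (fun _ : (thetaIndex X).Caps (Setting.labelSucc ⟨i, hil⟩) => x₀)) (Fin.last _) J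
    have hsum : dSum (pp : ℕ) ((presAt X hlog pp).kk (fun _ : (thetaIndex X).Caps (Setting.labelSucc ⟨i, hil⟩) => x₀)) =
        ((i : ℝ) + 2) * differentOrd (pp : ℕ) ((presAt X hlog pp).k x₀) := by
      unfold dSum
      dsimp only [Cor312Vol.PadicPresentation.kk]
      rw [Finset.sum_const, Finset.card_univ, hcard, nsmul_eq_mul]
      push_cast
      ring
    rw [heram', hsum]
    have hfac' : differentOrd (pp : ℕ) ((presAt X hlog pp).k x₀) ≤
        differentOrd (pp : ℕ) (DFac (pp : ℕ) ((presAt X hlog pp).kk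
          (fun _ : (thetaIndex X).Caps (Setting.labelSucc ⟨i, hil⟩) => x₀)) J) := hfac
    rw [hdiff] at hfac' ⊢
    have hI : (((⟨i, hil⟩ : Fin (thetaIndex X).lstar) : ℕ) : ℤ) = (i : ℤ) := rfl
    rw [hI]
    push_cast at hfac' ⊢
    linear_combination hfac'
  · -- hneg: the column fails at `(e, P_q) = (e₀, P)`
    rw [heram']
    exact hneg


/-- **… hence BRANCH C's PER-DATUM ANTECEDENT FAILS** at the `K`-level datum of the abc triple under the same hypotheses (pinned tame local type
at the pole `p`, failing column): there are NO `ρ`, `qK` with `QPinned ∧ PilotKummerCompatHull` at `settingPrVolSharp (pilotDataOfK T.D T.K) …`,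
for ANY columns `col` and EVERY pair of realising ideles — the binder shape of the window certificates' `hSHw`/`hSHwBad` (p453137 / p450130) is
REFUTED at these data (abc-iut-w5-d009's `exists_qPinned_and_hull_settingPrVolSharp_iff_licence`, realising q-ideles have norm `≤ 1`).
[cite: Mochizuki2012, IUTchIII Cor. 3.12 Step (xi-d) p. 183, (xi-f) p. 184] [cite: DupuyHilado2025, §3.4, §4.9, §4.12] [claim: Mochizuki2012, status: disputed] -/
theorem WRow.not_exists_qPinned_and_hull_triple_of_not_hullCell {a b c l : ℕ} (habc : IsABCTriple a b c)
    (T : Cor22.ThetaVolumeDatumAt (ratPoint ((a : ℚ) / c)) l) (pp : Nat.Primes) (hp2 : (pp : ℕ) ≠ 2) (hpl : (pp : ℕ) ≠ l)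
    (hpabc : (pp : ℕ) ∣ a * b * c) {e₀ P i a₀ : ℕ} (hpe : ¬ (pp : ℕ) ∣ e₀)
    (hloc : letI := T.instFieldF; letI := T.instNumberFieldF; letI := T.instAlgebraF; letI := T.instFieldK
      letI := T.instNumberFieldK; letI := T.instAlgebraK; letI := T.instFieldFbar; letI := T.instAlgebraFbar
      letI := T.instAlgebraKFbar; letI := T.instIsElliptic
      haveI : Fact (pp : ℕ).Prime := ⟨pp.2⟩
      ∀ x₀ : (thetaIndex (pilotDataOfK T.D T.K)).Fibre (.inr pp),
        absRamificationIdx (pp : ℕ) (kOf (pilotDataOfK T.D T.K) pp.1 x₀) = e₀)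
    (hP : e₀ * (a * b * c).factorization pp = l * P) (hi : i + 1 ≤ (l - 1) / 2)
    (hlo : ∀ t : ℕ, t < a₀ → (1 : ℤ) * ((pp : ℕ) : ℤ) ^ t * (((pp : ℕ) : ℤ) - 1) < (e₀ : ℤ))
    (hhi : (e₀ : ℤ) ≤ 1 * ((pp : ℕ) : ℤ) ^ a₀ * (((pp : ℕ) : ℤ) - 1))
    (hneg : ¬ HullCell (e₀ : ℤ) (P : ℤ) ((i : ℤ) + 1) ((e₀ / ((pp : ℕ) - 1) + 1 : ℕ) : ℤ)
      (((pp : ℕ) : ℤ) ^ a₀ - (a₀ : ℤ) * (e₀ : ℤ))) :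
    letI := T.instFieldF; letI := T.instNumberFieldF; letI := T.instAlgebraF; letI := T.instFieldK
    letI := T.instNumberFieldK; letI := T.instAlgebraK; letI := T.instFieldFbar; letI := T.instAlgebraFbar
    letI := T.instAlgebraKFbar; letI := T.instIsElliptic
    ∀ {logv : PadicLogs T.K} (hlog : LogvAnalytic logv) (M : Type) [Field M] [NumberField M]
      (archPk : ∀ (j : (thetaIndex (pilotDataOfK T.D T.K)).Label) (vQ : (thetaIndex (pilotDataOfK T.D T.K)).VQ),
        Set ((logShellsDH (pilotDataOfK T.D T.K) logv).Packet j vQ))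
      (archSub : ∀ (j : (thetaIndex (pilotDataOfK T.D T.K)).Label) (v : (thetaIndex (pilotDataOfK T.D T.K)).V),
        Set ((logShellsDH (pilotDataOfK T.D T.K) logv).Packet j ((thetaIndex (pilotDataOfK T.D T.K)).over v)))
      (Ψ : ℤ → ∀ v : (thetaIndex (pilotDataOfK T.D T.K)).V, v ∈ (thetaIndex (pilotDataOfK T.D T.K)).Vbad →
        Set ((logShellsDH (pilotDataOfK T.D T.K) logv).StarPacket v))
      (act : ℤ → ∀ v : (thetaIndex (pilotDataOfK T.D T.K)).V, v ∈ (thetaIndex (pilotDataOfK T.D T.K)).Vbad →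
        (logShellsDH (pilotDataOfK T.D T.K) logv).StarPacket v → Module.End ℚ ((logShellsDH (pilotDataOfK T.D T.K) logv).StarPacket v))
      (Mmod : ℤ → ∀ j : (thetaIndex (pilotDataOfK T.D T.K)).LabelStar, Set ((logShellsDH (pilotDataOfK T.D T.K) logv).GlobalPacket j.1))
      (region : ℤ → ∀ j : (thetaIndex (pilotDataOfK T.D T.K)).LabelStar, FinDivisor M → ∀ vQ : (thetaIndex (pilotDataOfK T.D T.K)).VQ,
        Set ((logShellsDH (pilotDataOfK T.D T.K) logv).Packet j.1 vQ))
      (n : ℤ) {HT : Type} {LogLink : HT → HT → Type} {IsFull : ∀ {s t : HT}, LogLink s t → Prop}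
      (lat : LGPGaussianLogThetaLattice LogLink IsFull)
      {Frd : Type} {IsoF : Frd → Frd → Type} {Ob : Frd → Type} {realify : Frd → Frd} {Strip : Type}
      {IsoS : Strip → Strip → Type} {Mv : ∀ v : (thetaIndex (pilotDataOfK T.D T.K)).V, v ∈ (thetaIndex (pilotDataOfK T.D T.K)).Vbad → Type}
      [∀ v h, Monoid (Mv v h)]
      (sig : GlobalLGPFrobenioidSignature (thetaIndex (pilotDataOfK T.D T.K)).lstar (thetaIndex (pilotDataOfK T.D T.K)).V
        (· ∈ (thetaIndex (pilotDataOfK T.D T.K)).Vbad) Frd IsoF Ob realify Strip IsoS Mv)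
      (split : SplittingMonoids Mv) {ObΔ : Type} {N : ∀ v : (thetaIndex (pilotDataOfK T.D T.K)).V, v ∈ (thetaIndex (pilotDataOfK T.D T.K)).Vbad → Type}
      [∀ v h, Monoid (N v h)] (qData : QPilotData ObΔ N)
      (tq : ∀ (pp : Nat.Primes) (x : (thetaIndex (pilotDataOfK T.D T.K)).Fibre (.inr pp)),
        haveI : Fact (pp : ℕ).Prime := ⟨pp.2⟩; kOf (pilotDataOfK T.D T.K) pp.1 x)
      (t : ∀ (pp : Nat.Primes) (_ : Fin (pilotDataOfK T.D T.K).lstar) (x : (thetaIndex (pilotDataOfK T.D T.K)).Fibre (.inr pp)),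
        haveI : Fact (pp : ℕ).Prime := ⟨pp.2⟩; kOf (pilotDataOfK T.D T.K) pp.1 x)
      (htq0 : ∀ pp x, tq pp x ≠ 0)
      (htq1 : ∀ (pp : Nat.Primes) (x : (thetaIndex (pilotDataOfK T.D T.K)).Fibre (.inr pp)),
        haveI : Fact (pp : ℕ).Prime := ⟨pp.2⟩; placeOf (pilotDataOfK T.D T.K) pp.1 x ∉ (pilotDataOfK T.D T.K).S → ‖tq pp x‖ = 1)
      (col : ℤ → Column (logShellsDH (pilotDataOfK T.D T.K) logv))
      (_ht0 : ∀ pp i x, t pp i x ≠ 0)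
      (_ht : ∀ (pp : Nat.Primes) (i : Fin (pilotDataOfK T.D T.K).lstar) (x : (thetaIndex (pilotDataOfK T.D T.K)).Fibre (.inr pp)),
        haveI : Fact (pp : ℕ).Prime := ⟨pp.2⟩
        Real.log ‖t pp i x‖ = -((pilotDataOfK T.D T.K).thetaPilot i (placeOf (pilotDataOfK T.D T.K) pp.1 x)) *
          logNorm T.K (placeOf (pilotDataOfK T.D T.K) pp.1 x) / localDegree T.K (placeOf (pilotDataOfK T.D T.K) pp.1 x))
      (_htq : ∀ (pp : Nat.Primes) (x : (thetaIndex (pilotDataOfK T.D T.K)).Fibre (.inr pp)),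
        haveI : Fact (pp : ℕ).Prime := ⟨pp.2⟩
        Real.log ‖tq pp x‖ = -((pilotDataOfK T.D T.K).qPilot (placeOf (pilotDataOfK T.D T.K) pp.1 x)) *
          logNorm T.K (placeOf (pilotDataOfK T.D T.K) pp.1 x) / localDegree T.K (placeOf (pilotDataOfK T.D T.K) pp.1 x)),
      ¬ ∃ (ρ : (∀ v : (thetaIndex (pilotDataOfK T.D T.K)).V, v ∈ (thetaIndex (pilotDataOfK T.D T.K)).Vbad →
              Set ((logShellsDH (pilotDataOfK T.D T.K) logv).StarPacket v)) →
            ∀ (j : (thetaIndex (pilotDataOfK T.D T.K)).Label) (vQ : (thetaIndex (pilotDataOfK T.D T.K)).VQ),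
              Set ((logShellsDH (pilotDataOfK T.D T.K) logv).Packet j vQ))
          (qK : ∀ v : (thetaIndex (pilotDataOfK T.D T.K)).V, v ∈ (thetaIndex (pilotDataOfK T.D T.K)).Vbad →
            Set ((logShellsDH (pilotDataOfK T.D T.K) logv).StarPacket v)),
          QPinned ({ toSituation := situationPrVol (pilotDataOfK T.D T.K) hlog M archPk archSub Ψ act Mmod region, col := col } :
              LatticeSituation (thetaIndex (pilotDataOfK T.D T.K)))
            (settingPrVolSharp (pilotDataOfK T.D T.K) hlog M archPk archSub Ψ act Mmod region n lat sig split qData tq t htq0 htq1) ρ qK ∧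
          PilotKummerCompatHull ({ toSituation := situationPrVol (pilotDataOfK T.D T.K) hlog M archPk archSub Ψ act Mmod region, col := col } :
              LatticeSituation (thetaIndex (pilotDataOfK T.D T.K)))
            (settingPrVolSharp (pilotDataOfK T.D T.K) hlog M archPk archSub Ψ act Mmod region n lat sig split qData tq t htq0 htq1) ρ qK := by
  letI := T.instFieldF; letI := T.instNumberFieldF; letI := T.instAlgebraF; letI := T.instFieldK
  letI := T.instNumberFieldK; letI := T.instAlgebraK; letI := T.instFieldFbar; letI := T.instAlgebraFbar
  letI := T.instAlgebraKFbar; letI := T.instIsElliptic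
  intro logv hlog M _ _ archPk archSub Ψ act Mmod region n HT LogLink IsFull lat Frd IsoF Ob realify Strip
    IsoS Mv _ sig split ObΔ N _ qData tq t htq0 htq1 col ht0 ht htq h
  have hL := (exists_qPinned_and_hull_settingPrVolSharp_iff_licence (pilotDataOfK T.D T.K) hlog M archPk archSub Ψ act Mmod region n
    lat sig split qData tq t htq0 htq1 col (fun pp x => norm_qIdele_le_one_of_realises (pilotDataOfK T.D T.K) tq htq0 htq pp x)).1 h
  exact WRow.not_licence_triple_of_not_hullCell habc T pp hp2 hpl hpabc hpe hloc hP hi hlo hhi hneg hlog M archPk archSub Ψ act Mmod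
    region n lat sig split qData tq t htq0 htq1 ht0 ht htq hL

end Summit.ABC.IUTFork.Conditional

end
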